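import Summits.Ventures.DiscreteObjects.PP12.PlanarExterior

/-!
# PP(12): no collineation of order 3 fixes a subplane of order 3 pointwise (the planar order-3 cell is EMPTY — kernel)
Framing: lottery ticket; floor = certified bounds/negative ranges.

**Theorem (`no_planar_order_three`).** A projective plane of order 12 (Mathlib `Configuration.ProjectivePlane`) admits no
collineation `σ` with `σ³ = 1` on points whose fixed structure is planar of order 3 (13 fixed points, 13 fixed lines, 4 fixed
points on every fixed line, 4 fixed lines through every fixed point). This is case 2 of `OrderThree.order_three_structure` — the
census sub-cell `NoPlanarOrder3Order12` of the live cell `|G| = 3` of a putative plane of order 12 (cell pub-namedobj, target M),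
carried so far as 'beyond bound k'. IN PRINT this is the case `(m, n) = (3, 12)` of Roth's theorem (R. Roth, Math. Z. 83 (1964)
409–421, §3; Dembowski, *Finite Geometries* (1968), 4.1.6: a fixed subplane of order `m` forces `m² = n` or `m(m+1) ≤ n − 2`); this
file is a kernel FORMALISATION of that case (replication, no novelty claim). (Akiyama–Suetake–Tanaka, Australas. J. Combin. 74
(2019) 112–160, Lemma 3.6 case (1), §4 and §6, treat the case by computer inside groups of order 9, without Roth's theorem.)

Proof (a double count, no computer; designs g10). Let `F` be the 13 fixed points and `X` the 27 exterior points (non-fixed, on no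
fixed line; `PlanarExterior`). Every line through an exterior point carries exactly one fixed point, and a non-fixed line through a
fixed point carries exactly 3 exterior points (`PlanarExterior`). For `x ∈ F` and `Q ∈ X` let `N_x(Q)` be the set of exterior points
collinear with `x` and one of `Q, σQ, σ²Q`. (i) The three lines `x·σⁱQ` are pairwise distinct (a line through the fixed point `x`
containing an exterior `Z` and `σZ` would be fixed) and each carries 3 exterior points, so `|N_x(Q)| = 9` and
`T := Σ_{x ∈ F} Σ_{Q ∈ X} |N_x(Q)| = 13·27·9 = 3159`. (ii) Exchanging the sums, `T = Σ_{Q, Q' ∈ X} c(Q,Q')` with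
`c(Q,Q') = #{x ∈ F : Q' ∈ N_x(Q)}`; if `Q' ∉ {Q, σQ, σ²Q}` then `c(Q,Q') ≤ 3` (a fixed point collinear with `Q'` and `σⁱQ ≠ Q'`
is THE fixed point of the line `Q'·σⁱQ`), and always `c ≤ 13`; hence `Σ_{Q'} c(Q,Q') ≤ 3·27 + 10·3 = 111` and
`T ≤ 27·111 = 2997 < 3159`. Contradiction. Everything is proved; no `sorry`, no new axioms, no new definitions.
-/

namespace Summit.Ventures.DiscreteObjects.PP12

open Configuration Finset
open scoped Classical

namespace Collineation

variable {P L : Type*} [Membership P L] [ProjectivePlane P L] [Fintype P] [Fintype L]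
  [DecidableEq P] [DecidableEq L] (σ : Collineation P L)

omit [ProjectivePlane P L] [Fintype P] [Fintype L] [DecidableEq P] [DecidableEq L] in
/-- The exterior points are permuted by `σ`: if `Q` is non-fixed and on no fixed line, so is `σQ`. -/
theorem map_exterior {Q : P} (hQ : σ.onPoints Q ≠ Q ∧ ∀ l : L, σ.onLines l = l → Q ∉ l) :
    σ.onPoints (σ.onPoints Q) ≠ σ.onPoints Q ∧ ∀ l : L, σ.onLines l = l → σ.onPoints Q ∉ l := by
  refine ⟨fun h => hQ.1 (σ.onPoints.injective h), fun l hl hmem => ?_⟩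
  exact hQ.2 l hl ((σ.mem_fixedLine_iff hl Q).1 hmem)

omit [Fintype P] [Fintype L] [DecidableEq P] [DecidableEq L] in
/-- Key rigidity: a line through a fixed point `x` and an exterior point `Z` does not contain `σZ`. -/
theorem map_not_mem_of_exterior {x Z : P} (hx : σ.onPoints x = x)
    (hZ : σ.onPoints Z ≠ Z ∧ ∀ l : L, σ.onLines l = l → Z ∉ l) {m : L} (hxm : x ∈ m) (hZm : Z ∈ m) :
    σ.onPoints Z ∉ m := by
  intro hσZ
  have hx' : x ∈ σ.onLines m := by simpa [hx] using σ.mem_map hxm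
  have hZ' : σ.onPoints Z ∈ σ.onLines m := σ.mem_map hZm
  have hne : x ≠ σ.onPoints Z := by
    intro e
    have hZx : Z = x := σ.onPoints.injective (by rw [hx]; exact e.symm)
    exact hZ.1 (by rw [hZx]; exact hx)
  have hfix : σ.onLines m = m := (Nondegenerate.eq_or_eq hx' hZ' hxm hσZ).resolve_left hne
  exact hZ.2 m hfix hZm

omit [DecidableEq L] in
/-- At most one fixed point is collinear with an exterior point `Q'` and a point `Z ≠ Q'`. -/
theorem card_fixed_collinear_le_one {Q' Z : P}
    (hQ' : σ.onPoints Q' ≠ Q' ∧ ∀ l : L, σ.onLines l = l → Q' ∉ l) (hZQ' : Z ≠ Q') :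
    ((univ.filter fun x : P => σ.onPoints x = x).filter
      fun x => ∃ m : L, x ∈ m ∧ Q' ∈ m ∧ Z ∈ m).card ≤ 1 := by
  refine Finset.card_le_one.mpr fun a ha b hb => ?_
  simp only [mem_filter, mem_univ, true_and] at ha hb
  obtain ⟨fa, m, ham, hQ'm, hZm⟩ := ha
  obtain ⟨fb, m', hbm', hQ'm', hZm'⟩ := hb
  have hmm' : m = m' := (Nondegenerate.eq_or_eq hZm hQ'm hZm' hQ'm').resolve_left hZQ'
  subst hmm'
  by_contra hab
  exact hQ'.2 m (σ.line_fixed_of_two_fixed ham hbm' hab fa fb) hQ'm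

omit [DecidableEq L] in
/-- (ii) If `Q'` is none of `Q, σQ, σ²Q` then at most 3 fixed points are collinear with `Q'` and one of `Q, σQ, σ²Q`. -/
theorem card_fixed_NRel_le_three {Q Q' : P}
    (hQ' : σ.onPoints Q' ≠ Q' ∧ ∀ l : L, σ.onLines l = l → Q' ∉ l) (h0 : Q' ≠ Q) (h1 : Q' ≠ σ.onPoints Q)
    (h2 : Q' ≠ σ.onPoints (σ.onPoints Q)) :
    ((univ.filter fun x : P => σ.onPoints x = x).filter fun x => ∃ m : L, x ∈ m ∧ Q' ∈ m ∧
      (Q ∈ m ∨ σ.onPoints Q ∈ m ∨ σ.onPoints (σ.onPoints Q) ∈ m)).card ≤ 3 := by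
  set F : Finset P := univ.filter fun x : P => σ.onPoints x = x with hF
  have hsub : (F.filter fun x => ∃ m : L, x ∈ m ∧ Q' ∈ m ∧ (Q ∈ m ∨ σ.onPoints Q ∈ m ∨ σ.onPoints (σ.onPoints Q) ∈ m)) ⊆
      (F.filter fun x => ∃ m : L, x ∈ m ∧ Q' ∈ m ∧ Q ∈ m) ∪
      (F.filter fun x => ∃ m : L, x ∈ m ∧ Q' ∈ m ∧ σ.onPoints Q ∈ m) ∪
      (F.filter fun x => ∃ m : L, x ∈ m ∧ Q' ∈ m ∧ σ.onPoints (σ.onPoints Q) ∈ m) := by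
    intro x hx
    simp only [mem_filter, mem_union] at hx ⊢
    obtain ⟨hxF, m, hxm, hQ'm, hZ⟩ := hx
    rcases hZ with hZ | hZ | hZ
    · exact Or.inl (Or.inl ⟨hxF, m, hxm, hQ'm, hZ⟩)
    · exact Or.inl (Or.inr ⟨hxF, m, hxm, hQ'm, hZ⟩)
    · exact Or.inr ⟨hxF, m, hxm, hQ'm, hZ⟩
  refine (Finset.card_le_card hsub).trans ?_
  refine (Finset.card_union_le _ _).trans ?_
  have ha := σ.card_fixed_collinear_le_one hQ' (Ne.symm h0)
  have hb := σ.card_fixed_collinear_le_one hQ' (Ne.symm h1)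
  have hc := σ.card_fixed_collinear_le_one hQ' (Ne.symm h2)
  have hab := Finset.card_union_le (F.filter fun x => ∃ m : L, x ∈ m ∧ Q' ∈ m ∧ Q ∈ m)
    (F.filter fun x => ∃ m : L, x ∈ m ∧ Q' ∈ m ∧ σ.onPoints Q ∈ m)
  rw [hF] at hab ⊢
  omega

section Planar

variable (h12 : ProjectivePlane.order P L = 12)
include h12

/-- A line through a fixed point `x` and an exterior point `Z` carries exactly 3 exterior points (planar setting). -/
theorem card_exterior_on_line (hg13 : fixedCard σ.onLines = 13) (ht4 : ∀ x : P, σ.onPoints x = x → σ.fixedThrough x = 4)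
    {x : P} (hx : σ.onPoints x = x) {m : L} (hxm : x ∈ m) {Z : P}
    (hZ : σ.onPoints Z ≠ Z ∧ ∀ l : L, σ.onLines l = l → Z ∉ l) (hZm : Z ∈ m) :
    ((univ.filter fun y : P => σ.onPoints y ≠ y ∧ ∀ l : L, σ.onLines l = l → y ∉ l).filter fun y => y ∈ m).card = 3 := by
  have hm : σ.onLines m ≠ m := fun fm => hZ.2 m fm hZm
  have h := (σ.tangent_line_counts h12 hg13 ht4 hm hx hxm).2.2
  rw [← h]
  congr 1
  ext y
  simp only [mem_filter, mem_univ, true_and]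
  tauto

/-- (i) `|N_x(Q)| = 9`: exactly 9 exterior points are collinear with the fixed point `x` and one of `Q, σQ, σ²Q`. -/
theorem card_NRel_eq_nine (hq : σ.onPoints ^ 3 = 1) (hg13 : fixedCard σ.onLines = 13)
    (ht4 : ∀ x : P, σ.onPoints x = x → σ.fixedThrough x = 4) {x : P} (hx : σ.onPoints x = x) {Q : P}
    (hQ : σ.onPoints Q ≠ Q ∧ ∀ l : L, σ.onLines l = l → Q ∉ l) :
    ((univ.filter fun y : P => σ.onPoints y ≠ y ∧ ∀ l : L, σ.onLines l = l → y ∉ l).filter fun Q' =>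
      ∃ m : L, x ∈ m ∧ Q' ∈ m ∧ (Q ∈ m ∨ σ.onPoints Q ∈ m ∨ σ.onPoints (σ.onPoints Q) ∈ m)).card = 9 := by
  set X : Finset P := univ.filter fun y : P => σ.onPoints y ≠ y ∧ ∀ l : L, σ.onLines l = l → y ∉ l with hXdef
  -- the three points Q, Q₁ = σQ, Q₂ = σ²Q are exterior, and σ Q₂ = Q
  set Q₁ := σ.onPoints Q with hQ₁
  set Q₂ := σ.onPoints Q₁ with hQ₂
  have hQ₁X : σ.onPoints Q₁ ≠ Q₁ ∧ ∀ l : L, σ.onLines l = l → Q₁ ∉ l := σ.map_exterior hQ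
  have hQ₂X : σ.onPoints Q₂ ≠ Q₂ ∧ ∀ l : L, σ.onLines l = l → Q₂ ∉ l := σ.map_exterior hQ₁X
  have hQ₃ : σ.onPoints Q₂ = Q := by
    have := congrArg (fun τ : Equiv.Perm P => τ Q) hq
    simpa [pow_succ, Equiv.Perm.mul_apply] using this
  -- x differs from exterior points
  have hne : ∀ {Z : P}, (σ.onPoints Z ≠ Z ∧ ∀ l : L, σ.onLines l = l → Z ∉ l) → x ≠ Z :=
    fun hZ e => hZ.1 (e ▸ hx)
  -- the three lines
  set ℓ₀ : L := HasLines.mkLine (hne hQ) with hℓ₀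
  set ℓ₁ : L := HasLines.mkLine (hne hQ₁X) with hℓ₁
  set ℓ₂ : L := HasLines.mkLine (hne hQ₂X) with hℓ₂
  have h₀ : x ∈ ℓ₀ ∧ Q ∈ ℓ₀ := HasLines.mkLine_ax (hne hQ)
  have h₁ : x ∈ ℓ₁ ∧ Q₁ ∈ ℓ₁ := HasLines.mkLine_ax (hne hQ₁X)
  have h₂ : x ∈ ℓ₂ ∧ Q₂ ∈ ℓ₂ := HasLines.mkLine_ax (hne hQ₂X)
  -- collinearity with x and Z ≠ x is membership in THE line xZ
  have key : ∀ {Z : P}, (σ.onPoints Z ≠ Z ∧ ∀ l : L, σ.onLines l = l → Z ∉ l) → ∀ {ℓ : L}, x ∈ ℓ → Z ∈ ℓ →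
      ∀ {Q' : P} {m : L}, x ∈ m → Q' ∈ m → Z ∈ m → Q' ∈ ℓ := by
    intro Z hZ ℓ hxℓ hZℓ Q' m hxm hQ'm hZm
    have : m = ℓ := (Nondegenerate.eq_or_eq hxm hZm hxℓ hZℓ).resolve_left (hne hZ)
    exact this ▸ hQ'm
  -- rewrite the filter as a union of three line-sections
  have hset : (X.filter fun Q' => ∃ m : L, x ∈ m ∧ Q' ∈ m ∧ (Q ∈ m ∨ σ.onPoints Q ∈ m ∨ σ.onPoints (σ.onPoints Q) ∈ m))
      = (X.filter fun y => y ∈ ℓ₀) ∪ (X.filter fun y => y ∈ ℓ₁) ∪ (X.filter fun y => y ∈ ℓ₂) := by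
    ext Q'
    simp only [mem_filter, mem_union]
    constructor
    · rintro ⟨hQ'X, m, hxm, hQ'm, hZ⟩
      rcases hZ with hZ | hZ | hZ
      · exact Or.inl (Or.inl ⟨hQ'X, key hQ h₀.1 h₀.2 hxm hQ'm hZ⟩)
      · exact Or.inl (Or.inr ⟨hQ'X, key hQ₁X h₁.1 h₁.2 hxm hQ'm hZ⟩)
      · exact Or.inr ⟨hQ'X, key hQ₂X h₂.1 h₂.2 hxm hQ'm hZ⟩
    · rintro ((⟨hQ'X, h⟩ | ⟨hQ'X, h⟩) | ⟨hQ'X, h⟩)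
      · exact ⟨hQ'X, ℓ₀, h₀.1, h, Or.inl h₀.2⟩
      · exact ⟨hQ'X, ℓ₁, h₁.1, h, Or.inr (Or.inl h₁.2)⟩
      · exact ⟨hQ'X, ℓ₂, h₂.1, h, Or.inr (Or.inr h₂.2)⟩
  -- the three lines are pairwise distinct
  have d01 : ℓ₀ ≠ ℓ₁ := fun e => σ.map_not_mem_of_exterior hx hQ h₀.1 h₀.2 (e ▸ h₁.2)
  have d12 : ℓ₁ ≠ ℓ₂ := fun e => σ.map_not_mem_of_exterior hx hQ₁X h₁.1 h₁.2 (e ▸ h₂.2)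
  have d02 : ℓ₀ ≠ ℓ₂ := by
    intro e
    apply σ.map_not_mem_of_exterior hx hQ₂X h₂.1 h₂.2
    rw [hQ₃, ← e]; exact h₀.2
  -- two distinct lines through x share no exterior point
  have disj : ∀ {ℓ ℓ' : L}, x ∈ ℓ → x ∈ ℓ' → ℓ ≠ ℓ' →
      Disjoint (X.filter fun y => y ∈ ℓ) (X.filter fun y => y ∈ ℓ') := by
    intro ℓ ℓ' hxℓ hxℓ' hℓℓ'
    rw [Finset.disjoint_left]
    intro y hy hy'
    rw [mem_filter] at hy hy'
    have hyX : σ.onPoints y ≠ y ∧ ∀ l : L, σ.onLines l = l → y ∉ l := by simpa [hXdef] using hy.1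
    have : y = x := (Nondegenerate.eq_or_eq hy.2 hxℓ hy'.2 hxℓ').resolve_right hℓℓ'
    exact (hne hyX) this.symm
  rw [hset, Finset.card_union_of_disjoint, Finset.card_union_of_disjoint (disj h₀.1 h₁.1 d01)]
  · rw [hXdef, σ.card_exterior_on_line h12 hg13 ht4 hx h₀.1 hQ h₀.2,
      σ.card_exterior_on_line h12 hg13 ht4 hx h₁.1 hQ₁X h₁.2, σ.card_exterior_on_line h12 hg13 ht4 hx h₂.1 hQ₂X h₂.2]
  · rw [Finset.disjoint_union_left]
    exact ⟨disj h₀.1 h₂.1 d02, disj h₁.1 h₂.1 d12⟩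

/-- **No planar collineation of order 3 on a projective plane of order 12.** -/
theorem no_planar_order_three (hq : σ.onPoints ^ 3 = 1) (hf13 : fixedCard σ.onPoints = 13)
    (hg13 : fixedCard σ.onLines = 13) (hk4 : ∀ l : L, σ.onLines l = l → σ.fixedOnLine l = 4)
    (ht4 : ∀ x : P, σ.onPoints x = x → σ.fixedThrough x = 4) : False := by
  set X : Finset P := univ.filter fun y : P => σ.onPoints y ≠ y ∧ ∀ l : L, σ.onLines l = l → y ∉ l with hXdef
  set F : Finset P := univ.filter fun x : P => σ.onPoints x = x with hFdef
  have hX : X.card = 27 := σ.card_exterior_points h12 hf13 hg13 hk4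
  have hF : F.card = 13 := hf13
  -- the counting relation
  let R : P → P → P → Prop := fun x Q Q' =>
    ∃ m : L, x ∈ m ∧ Q' ∈ m ∧ (Q ∈ m ∨ σ.onPoints Q ∈ m ∨ σ.onPoints (σ.onPoints Q) ∈ m)
  set T := ∑ x ∈ F, ∑ Q ∈ X, (X.filter fun Q' => R x Q Q').card with hT
  -- (i) T = 13 * 27 * 9
  have hT1 : T = 13 * (27 * 9) := by
    have h9 : ∀ x ∈ F, ∀ Q ∈ X, (X.filter fun Q' => R x Q Q').card = 9 := by
      intro x hx Q hQ
      have hx' : σ.onPoints x = x := by simpa [hFdef] using hx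
      have hQ' : σ.onPoints Q ≠ Q ∧ ∀ l : L, σ.onLines l = l → Q ∉ l := by simpa [hXdef] using hQ
      exact σ.card_NRel_eq_nine h12 hq hg13 ht4 hx' hQ'
    rw [hT, Finset.sum_congr rfl (fun x hx => Finset.sum_congr rfl (fun Q hQ => h9 x hx Q hQ))]
    simp [hX, hF]
  -- (ii) exchange the sums
  have hT2 : T = ∑ Q ∈ X, ∑ Q' ∈ X, (F.filter fun x => R x Q Q').card := by
    rw [hT]
    simp only [Finset.card_filter]
    rw [Finset.sum_comm]
    refine Finset.sum_congr rfl fun Q _ => ?_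
    rw [Finset.sum_comm]
  -- bound the inner sum by 111 for each Q
  have hinner : ∀ Q ∈ X, ∑ Q' ∈ X, (F.filter fun x => R x Q Q').card ≤ 111 := by
    intro Q hQ
    -- pointwise bound: 13 on {Q, σQ, σ²Q}, 3 elsewhere
    let S3 : Finset P := {Q, σ.onPoints Q, σ.onPoints (σ.onPoints Q)}
    have hS3card : S3.card ≤ 3 := by
      refine (Finset.card_insert_le _ _).trans ?_
      have := Finset.card_insert_le (σ.onPoints Q) ({σ.onPoints (σ.onPoints Q)} : Finset P)
      simp only [Finset.card_singleton] at this
      omega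
    have hpt : ∀ Q' ∈ X, (F.filter fun x => R x Q Q').card ≤ 3 + (if Q' ∈ S3 then 10 else 0) := by
      intro Q' hQ'
      by_cases hmem : Q' ∈ S3
      · rw [if_pos hmem]
        have : (F.filter fun x => R x Q Q').card ≤ F.card := Finset.card_filter_le _ _
        omega
      · rw [if_neg hmem]
        have hQ'X : σ.onPoints Q' ≠ Q' ∧ ∀ l : L, σ.onLines l = l → Q' ∉ l := by simpa [hXdef] using hQ'
        have h0 : Q' ≠ Q := fun e => hmem (by simp [S3, e])
        have h1 : Q' ≠ σ.onPoints Q := fun e => hmem (by simp [S3, e])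
        have h2 : Q' ≠ σ.onPoints (σ.onPoints Q) := fun e => hmem (by simp [S3, e])
        have := σ.card_fixed_NRel_le_three hQ'X h0 h1 h2
        rw [hFdef]
        omega
    refine (Finset.sum_le_sum hpt).trans ?_
    rw [Finset.sum_add_distrib, Finset.sum_const, hX, smul_eq_mul]
    have hite : ∑ Q' ∈ X, (if Q' ∈ S3 then 10 else 0) = 10 * (X.filter fun Q' => Q' ∈ S3).card := by
      rw [← Finset.sum_filter, Finset.sum_const, smul_eq_mul, mul_comm]
    have hsub : (X.filter fun Q' => Q' ∈ S3).card ≤ 3 :=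
      (Finset.card_le_card (fun y hy => (Finset.mem_filter.1 hy).2)).trans hS3card
    rw [hite]
    omega
  have hT3 : T ≤ 27 * 111 := by
    rw [hT2]
    refine (Finset.sum_le_sum hinner).trans ?_
    rw [Finset.sum_const, hX, smul_eq_mul]
  omega

end Planar

end Collineation

end Summit.Ventures.DiscreteObjects.PP12
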